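import Literature.Analysis.InverseSpectral.StieltjesInversion
import Literature.Analysis.Complex.PickFunctionsProofs
import HarnessLib

/-!
# Rational Stieltjes functions: the inverse Stieltjes step

For a finitely atomic Stieltjes measure `σ = Σ_{λ ∈ s} c_λ δ_λ` (`s ⊂ [0, ∞)` finite, `c_λ > 0`) put
`N(z) = Σ c_λ/(λ - z)` (`= ∫ dσ/(λ - z)`) and `D(z) = Σ c_λ λ/(λ - z)`. The inverse of the
point-mass step of Stieltjes' continued fraction (`KreinStringOperations`) is
`N ↦ r = N/(m₀ D)`, `m₀ = 1/Σ c_λ` (so that `N = r/(1 - z m₀ r)`); this file proves the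
positivity properties of `r` needed to see that `r` is again a Stieltjes function:
`Im (N · conj D) = (Im z / 2) Σ_{λ,μ} a_λ a_μ (λ - μ)² ≥ 0` with `a_λ = c_λ/|λ - z|²`
(`im_ratNum_mul_conj_ratDen`), whence `Im r ≥ 0` on `ℂ⁺`. (Stieltjes 1894; Kac–Kreĭn 1974 §2,
Supplement II.)

## References

KacKrein1974 (§2, Supplement II), DymMcKean1976 (§5.8).
-/

open Finset Complex MeasureTheory Filter Topology
open scoped ComplexConjugate ENNReal

noncomputable section

namespace Literature.Analysis.InverseSpectral

namespace StieltjesRational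

variable (s : Finset ℝ) (c : ℝ → ℝ)

/-- `N(z) = Σ c_λ/(λ - z)`, the Stieltjes transform of `Σ c_λ δ_λ`. [cite: KacKrein1974, §2] -/
def ratNum (z : ℂ) : ℂ := ∑ l ∈ s, (c l : ℂ) / ((l : ℂ) - z)

/-- `D(z) = Σ c_λ λ/(λ - z)` (`= Σ c_λ + z N(z)`). [cite: KacKrein1974, §2] -/
def ratDen (z : ℂ) : ℂ := ∑ l ∈ s, (c l : ℂ) * l / ((l : ℂ) - z)

variable {s c}

/-- `D = Σ c + z N`. [folklore] -/
lemma ratDen_eq (z : ℂ) (hz : ∀ l ∈ s, (l : ℂ) - z ≠ 0) :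
    ratDen s c z = (∑ l ∈ s, (c l : ℂ)) + z * ratNum s c z := by
  unfold ratDen ratNum
  rw [mul_sum, ← sum_add_distrib]
  refine sum_congr rfl (fun l hl => ?_)
  field_simp [hz l hl]
  ring

/-- The weight `a_λ = c_λ/|λ - z|²`. [folklore] -/
def wt (c : ℝ → ℝ) (z : ℂ) (l : ℝ) : ℝ := c l / Complex.normSq ((l : ℂ) - z)

/-- `c_λ/(λ - z) = a_λ · conj (λ - z)`. [folklore] -/
lemma term_num_eq (z : ℂ) {l : ℝ} (hl : (l : ℂ) - z ≠ 0) :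
    (c l : ℂ) / ((l : ℂ) - z) = (wt c z l : ℂ) * conj ((l : ℂ) - z) := by
  have hn : (Complex.normSq ((l : ℂ) - z) : ℂ) ≠ 0 := by
    exact_mod_cast (Complex.normSq_pos.2 hl).ne'
  rw [div_eq_iff hl, wt, Complex.ofReal_div, mul_assoc, ← Complex.normSq_eq_conj_mul_self]
  field_simp

/-- `conj (c_μ μ/(μ - z)) = a_μ μ · (μ - z)`. [folklore] -/
lemma conj_term_den_eq (z : ℂ) {m : ℝ} (hm : (m : ℂ) - z ≠ 0) :
    conj ((c m : ℂ) * m / ((m : ℂ) - z)) = (wt c z m : ℂ) * m * ((m : ℂ) - z) := by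
  have h1 : (c m : ℂ) * m / ((m : ℂ) - z) = (m : ℂ) * ((c m : ℂ) / ((m : ℂ) - z)) := by ring
  rw [h1, term_num_eq z hm, map_mul, map_mul, Complex.conj_ofReal, Complex.conj_ofReal,
    Complex.conj_conj]
  ring

/-- The basic identity behind `Im r ≥ 0`:
`Im (N(z) conj D(z)) = (Im z/2) Σ_{λ, μ} a_λ a_μ (λ - μ)²`, `a_λ = c_λ/|λ - z|²`.
[cite: KacKrein1974, §2] -/
theorem im_ratNum_mul_conj_ratDen (z : ℂ) (hz : ∀ l ∈ s, (l : ℂ) - z ≠ 0) :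
    (ratNum s c z * conj (ratDen s c z)).im =
      z.im / 2 * ∑ l ∈ s, ∑ m ∈ s, wt c z l * wt c z m * (l - m) ^ 2 := by
  have hterm : ∀ l ∈ s, ∀ m ∈ s,
      ((c l : ℂ) / ((l : ℂ) - z) * conj ((c m : ℂ) * m / ((m : ℂ) - z))).im =
        z.im * (wt c z l * wt c z m * (m * (m - l))) := by
    intro l hl m hm
    rw [term_num_eq z (hz l hl), conj_term_den_eq z (hz m hm)]
    simp only [Complex.mul_im, Complex.mul_re, Complex.ofReal_re, Complex.ofReal_im,
      Complex.conj_re, Complex.conj_im, Complex.sub_re, Complex.sub_im]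
    ring
  -- expand the product of sums
  have hprod : ratNum s c z * conj (ratDen s c z) =
      ∑ l ∈ s, ∑ m ∈ s, (c l : ℂ) / ((l : ℂ) - z) * conj ((c m : ℂ) * m / ((m : ℂ) - z)) := by
    unfold ratNum ratDen
    rw [map_sum, Finset.sum_mul_sum]
  rw [hprod, Complex.im_sum]
  simp_rw [Complex.im_sum]
  rw [Finset.sum_congr rfl (fun l hl => Finset.sum_congr rfl (fun m hm => hterm l hl m hm))]
  -- symmetrise
  have hswap : ∑ l ∈ s, ∑ m ∈ s, z.im * (wt c z l * wt c z m * (m * (m - l))) =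
      ∑ l ∈ s, ∑ m ∈ s, z.im * (wt c z l * wt c z m * (l * (l - m))) := by
    rw [Finset.sum_comm]
    refine Finset.sum_congr rfl (fun l _ => Finset.sum_congr rfl (fun m _ => by ring))
  have h2 : 2 * ∑ l ∈ s, ∑ m ∈ s, z.im * (wt c z l * wt c z m * (m * (m - l))) =
      z.im * ∑ l ∈ s, ∑ m ∈ s, wt c z l * wt c z m * (l - m) ^ 2 := by
    rw [two_mul]
    nth_rewrite 1 [hswap]
    rw [← Finset.sum_add_distrib, Finset.mul_sum]
    refine Finset.sum_congr rfl (fun l _ => ?_)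
    rw [← Finset.sum_add_distrib, Finset.mul_sum]
    refine Finset.sum_congr rfl (fun m _ => by ring)
  linarith

/-- **`Im (N conj D) ≥ 0` on the upper half-plane** (for positive weights).
[cite: KacKrein1974, §2] -/
theorem im_ratNum_mul_conj_ratDen_nonneg (hc : ∀ l ∈ s, 0 ≤ c l) {z : ℂ} (hz : 0 < z.im) :
    0 ≤ (ratNum s c z * conj (ratDen s c z)).im := by
  have hz' : ∀ l ∈ s, (l : ℂ) - z ≠ 0 := fun l _ h0 => by
    have := congrArg Complex.im h0
    simp at this
    linarith
  rw [im_ratNum_mul_conj_ratDen z hz']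
  refine mul_nonneg (by positivity) (Finset.sum_nonneg fun l hl => Finset.sum_nonneg fun m hm => ?_)
  have hl0 : 0 ≤ wt c z l := div_nonneg (hc l hl) (Complex.normSq_nonneg _)
  have hm0 : 0 ≤ wt c z m := div_nonneg (hc m hm) (Complex.normSq_nonneg _)
  positivity

/-- **`Im (N/D) ≥ 0` on the upper half-plane.** [cite: KacKrein1974, §2] -/
theorem im_ratNum_div_ratDen_nonneg (hc : ∀ l ∈ s, 0 ≤ c l) {z : ℂ} (hz : 0 < z.im) :
    0 ≤ (ratNum s c z / ratDen s c z).im := by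
  rw [div_eq_mul_inv, Complex.inv_def, ← mul_assoc, Complex.mul_im]
  simp only [Complex.ofReal_re, Complex.ofReal_im, mul_zero, zero_add]
  refine mul_nonneg (im_ratNum_mul_conj_ratDen_nonneg hc hz) ?_
  exact inv_nonneg.2 (Complex.normSq_nonneg _)

/-! ### `N`, `D` and `r = (Σ c) N/D` off `[0, ∞)` -/

/-- Off `[0, ∞)` no denominator vanishes. [folklore] -/
lemma sub_ne_zero_of_mem (hs : ∀ l ∈ s, 0 ≤ l) {z : ℂ} (hz : z ∈ offNonnegAxis) :
    ∀ l ∈ s, (l : ℂ) - z ≠ 0 := by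
  intro l hl h0
  have hzl : z = (l : ℂ) := (sub_eq_zero.1 h0).symm
  rcases hz with him | hre
  · exact him (by rw [hzl, Complex.ofReal_im])
  · rw [hzl, Complex.ofReal_re] at hre
    linarith [hs l hl]

/-- `N` is holomorphic off `[0, ∞)`. [folklore] -/
theorem differentiableOn_ratNum (hs : ∀ l ∈ s, 0 ≤ l) :
    DifferentiableOn ℂ (ratNum s c) offNonnegAxis := by
  intro z hz
  refine (DifferentiableAt.fun_sum (fun l hl => ?_)).differentiableWithinAt
  exact (differentiableAt_const _).div ((differentiableAt_const _).sub differentiableAt_id)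
    (sub_ne_zero_of_mem hs hz l hl)

/-- `D` is holomorphic off `[0, ∞)`. [folklore] -/
theorem differentiableOn_ratDen (hs : ∀ l ∈ s, 0 ≤ l) :
    DifferentiableOn ℂ (ratDen s c) offNonnegAxis := by
  intro z hz
  refine (DifferentiableAt.fun_sum (fun l hl => ?_)).differentiableWithinAt
  exact (differentiableAt_const _).div ((differentiableAt_const _).sub differentiableAt_id)
    (sub_ne_zero_of_mem hs hz l hl)

/-- `Im D(z) = Im z · Σ c_λ λ/|λ - z|²`. [folklore] -/
lemma im_ratDen (hs : ∀ l ∈ s, 0 ≤ l) {z : ℂ} (hz : z ∈ offNonnegAxis) :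
    (ratDen s c z).im = z.im * ∑ l ∈ s, c l * l / Complex.normSq ((l : ℂ) - z) := by
  unfold ratDen
  rw [Complex.im_sum, Finset.mul_sum]
  refine Finset.sum_congr rfl (fun l hl => ?_)
  have h0 := sub_ne_zero_of_mem hs hz l hl
  have hn : Complex.normSq ((l : ℂ) - z) ≠ 0 := (Complex.normSq_pos.2 h0).ne'
  rw [Complex.div_im]
  simp only [Complex.mul_re, Complex.mul_im, Complex.ofReal_re, Complex.ofReal_im, Complex.sub_re,
    Complex.sub_im, mul_zero, sub_zero, zero_mul, add_zero, zero_sub]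
  field_simp
  ring

/-- `N(-t) = Σ c_λ/(λ + t)` is real. [folklore] -/
lemma ratNum_neg (t : ℝ) : ratNum s c (-(t : ℂ)) = ((∑ l ∈ s, c l / (l + t) : ℝ) : ℂ) := by
  unfold ratNum
  push_cast
  refine Finset.sum_congr rfl (fun l _ => by ring)

/-- `D(-t) = Σ c_λ λ/(λ + t)` is real. [folklore] -/
lemma ratDen_neg (t : ℝ) : ratDen s c (-(t : ℂ)) = ((∑ l ∈ s, c l * l / (l + t) : ℝ) : ℂ) := by
  unfold ratDen
  push_cast
  refine Finset.sum_congr rfl (fun l _ => by ring)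

/-- **`D` does not vanish off `[0, ∞)`** (some atom lies in `(0, ∞)`). [cite: KacKrein1974, §2] -/
theorem ratDen_ne_zero (hs : ∀ l ∈ s, 0 ≤ l) (hc : ∀ l ∈ s, 0 < c l) (hpos : ∃ l ∈ s, 0 < l)
    {z : ℂ} (hz : z ∈ offNonnegAxis) : ratDen s c z ≠ 0 := by
  obtain ⟨l₀, hl₀, hl₀pos⟩ := hpos
  have hsum : 0 < ∑ l ∈ s, c l * l / Complex.normSq ((l : ℂ) - z) := by
    refine Finset.sum_pos' (fun l hl => ?_) ⟨l₀, hl₀, ?_⟩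
    · exact div_nonneg (mul_nonneg (hc l hl).le (hs l hl)) (Complex.normSq_nonneg _)
    · exact div_pos (mul_pos (hc l₀ hl₀) hl₀pos)
        (Complex.normSq_pos.2 (sub_ne_zero_of_mem hs hz l₀ hl₀))
  by_cases him : z.im = 0
  · -- `z = -t` with `t > 0`
    have hre : z.re < 0 := by
      rcases hz with h | h
      · exact absurd him h
      · exact h
    have hzt : z = -((-z.re : ℝ) : ℂ) := by
      apply Complex.ext <;> simp [him]
    rw [hzt, ratDen_neg]
    norm_cast
    refine (Finset.sum_pos' (fun l hl => ?_) ⟨l₀, hl₀, ?_⟩).ne'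
    · exact div_nonneg (mul_nonneg (hc l hl).le (hs l hl)) (by linarith [hs l hl])
    · exact div_pos (mul_pos (hc l₀ hl₀) hl₀pos) (by linarith)
  · intro h0
    have h := im_ratDen (c := c) hs hz
    rw [h0, Complex.zero_im] at h
    exact (mul_ne_zero him hsum.ne') h.symm

/-- The function produced by the inverse Stieltjes step: `r = (Σ c) · N/D`, so that
`N = r/(1 - z m₀ r)` with `m₀ = 1/Σ c`. [cite: KacKrein1974, §2] -/
def ratNext (s : Finset ℝ) (c : ℝ → ℝ) (z : ℂ) : ℂ :=
  ((∑ l ∈ s, c l : ℝ) : ℂ) * (ratNum s c z / ratDen s c z)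

/-- Unfolding of `ratNext`. [folklore] -/
lemma ratNext_def (z : ℂ) :
    ratNext s c z = ((∑ l ∈ s, c l : ℝ) : ℂ) * (ratNum s c z / ratDen s c z) := rfl

/-- **The inverse step inverts the point-mass step**: `N = r/(1 - z m₀ r)` off `[0, ∞)`,
`m₀ = 1/Σ c_λ`, and the denominator does not vanish. [cite: KacKrein1974, §2] -/
theorem ratNum_eq_ratNext_div (hs : ∀ l ∈ s, 0 ≤ l) (hc : ∀ l ∈ s, 0 < c l)
    (hpos : ∃ l ∈ s, 0 < l) {z : ℂ} (hz : z ∈ offNonnegAxis) :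
    1 - z * ((∑ l ∈ s, c l : ℝ) : ℂ)⁻¹ * ratNext s c z ≠ 0 ∧
      ratNum s c z = ratNext s c z / (1 - z * ((∑ l ∈ s, c l : ℝ) : ℂ)⁻¹ * ratNext s c z) := by
  obtain ⟨l₀, hl₀, hl₀pos⟩ := hpos
  have hC : ((∑ l ∈ s, c l : ℝ) : ℂ) ≠ 0 := by
    exact_mod_cast (Finset.sum_pos' (fun l hl => (hc l hl).le) ⟨l₀, hl₀, hc l₀ hl₀⟩).ne'
  have hD := ratDen_ne_zero hs hc ⟨l₀, hl₀, hl₀pos⟩ hz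
  have hDeq := ratDen_eq (c := c) z (sub_ne_zero_of_mem hs hz)
  rw [← Complex.ofReal_sum] at hDeq
  have hkey : 1 - z * ((∑ l ∈ s, c l : ℝ) : ℂ)⁻¹ * ratNext s c z =
      ((∑ l ∈ s, c l : ℝ) : ℂ) / ratDen s c z := by
    rw [ratNext_def]
    field_simp
    rw [hDeq]
    ring
  refine ⟨by rw [hkey]; exact div_ne_zero hC hD, ?_⟩
  rw [hkey, ratNext_def]
  field_simp

/-- **`Im r ≥ 0` on the upper half-plane.** [cite: KacKrein1974, §2] -/
theorem im_ratNext_nonneg (hc : ∀ l ∈ s, 0 < c l) {z : ℂ} (hz : 0 < z.im) :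
    0 ≤ (ratNext s c z).im := by
  rw [ratNext_def, Complex.im_ofReal_mul]
  exact mul_nonneg (Finset.sum_nonneg fun l hl => (hc l hl).le)
    (im_ratNum_div_ratDen_nonneg (fun l hl => (hc l hl).le) hz)

/-- **`r(-t) ≥ 0` is real for `t > 0`.** [cite: KacKrein1974, §2] -/
theorem ratNext_neg (hs : ∀ l ∈ s, 0 ≤ l) (hc : ∀ l ∈ s, 0 < c l) (t : ℝ) (ht : 0 < t) :
    (ratNext s c (-(t : ℂ))).im = 0 ∧ 0 ≤ (ratNext s c (-(t : ℂ))).re := by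
  rw [ratNext_def, ratNum_neg, ratDen_neg]
  norm_cast
  refine ⟨rfl, ?_⟩
  refine mul_nonneg (Finset.sum_nonneg fun l hl => (hc l hl).le) (div_nonneg ?_ ?_)
  · exact Finset.sum_nonneg fun l hl => div_nonneg (hc l hl).le (by linarith [hs l hl])
  · exact Finset.sum_nonneg fun l hl =>
      div_nonneg (mul_nonneg (hc l hl).le (hs l hl)) (by linarith [hs l hl])

/-- **Conjugation symmetry of `r`.** [folklore] -/
theorem ratNext_conj (z : ℂ) : ratNext s c (conj z) = conj (ratNext s c z) := by
  unfold ratNext ratNum ratDen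
  simp only [map_mul, map_div₀, map_sum, Complex.conj_ofReal, map_sub]

/-- **`r` is holomorphic off `[0, ∞)`.** [folklore] -/
theorem differentiableOn_ratNext (hs : ∀ l ∈ s, 0 ≤ l) (hc : ∀ l ∈ s, 0 < c l)
    (hpos : ∃ l ∈ s, 0 < l) : DifferentiableOn ℂ (ratNext s c) offNonnegAxis := by
  intro z hz
  exact ((differentiableOn_ratNum hs (c := c) z hz).div (differentiableOn_ratDen hs z hz)
    (ratDen_ne_zero hs hc hpos hz)).const_mul _

/-! ### `N` and `r` are Stieltjes functions -/

/-- **`N = ∫ dσ/(λ - z)` for `σ = Σ c_λ δ_λ`**: the finitely atomic Stieltjes data of `N`.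
[cite: KacKrein1974, §2] -/
theorem hasStieltjesRepresentation_ratNum (hs : ∀ l ∈ s, 0 ≤ l) (hc : ∀ l ∈ s, 0 ≤ c l) :
    HasStieltjesRepresentation (ratNum s c) 0
      (∑ l ∈ s, ENNReal.ofReal (c l) • Measure.dirac l) := by
  refine ⟨le_rfl, ?_, ?_, fun z hz => ?_⟩
  · simp only [Measure.coe_finsetSum, Measure.coe_smul, Finset.sum_apply, Pi.smul_apply,
      smul_eq_mul]
    refine Finset.sum_eq_zero (fun l hl => ?_)
    rw [Measure.dirac_apply' _ measurableSet_Iio, Set.indicator_of_notMem (by simpa using hs l hl),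
      mul_zero]
  · rw [MeasureTheory.lintegral_finsetSum_measure]
    refine ENNReal.sum_lt_top.2 (fun l hl => ?_)
    rw [lintegral_smul_measure, lintegral_dirac]
    exact ENNReal.mul_lt_top ENNReal.ofReal_lt_top ENNReal.ofReal_lt_top
  · rw [integral_finsetSum_measure (fun l hl => ?_)]
    · unfold ratNum
      push_cast
      rw [zero_add]
      refine Finset.sum_congr rfl (fun l hl => ?_)
      rw [integral_smul_measure, integral_dirac, ENNReal.toReal_ofReal (hc l hl), div_eq_mul_inv,
        Complex.real_smul]
    · exact ((integrable_dirac (by simp)).smul_measure ENNReal.ofReal_ne_top)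

/-- **The inverse Stieltjes step stays in the Stieltjes class**: `r = (Σ c) N/D ∈ N_S`
(some atom in `(0, ∞)`). [cite: KacKrein1974, §2] -/
theorem isNevanlinnaStieltjes_ratNext (hs : ∀ l ∈ s, 0 ≤ l) (hc : ∀ l ∈ s, 0 < c l)
    (hpos : ∃ l ∈ s, 0 < l) : IsNevanlinnaStieltjes (ratNext s c) :=
  isNevanlinnaStieltjes_of_nevanlinna_representation
    Literature.Analysis.Complex.nevanlinna_representation_holds
    (differentiableOn_ratNext hs hc hpos) (fun _ hz => im_ratNext_nonneg hc hz)
    (fun t ht => (ratNext_neg hs hc t ht).1) (fun t ht => (ratNext_neg hs hc t ht).2)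
    (fun z _ => ratNext_conj z)

/-! ### The real zeros of `D` off the atoms: at most `#{λ ∈ s : λ > 0} - 1` of them -/

/-- The real form of `D`: `D(x) = Σ c_λ λ/(λ - x)`. [folklore] -/
def ratDenReal (s : Finset ℝ) (c : ℝ → ℝ) (x : ℝ) : ℝ := ∑ l ∈ s, c l * l / (l - x)

/-- `D` restricted to the real axis. [folklore] -/
lemma ratDen_ofReal (x : ℝ) : ratDen s c (x : ℂ) = (ratDenReal s c x : ℂ) := by
  unfold ratDen ratDenReal
  push_cast
  rfl

/-- For nonnegative atoms only those in `(0, ∞)` contribute to `D`. [folklore] -/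
lemma ratDenReal_eq_pos (hs : ∀ l ∈ s, 0 ≤ l) (x : ℝ) :
    ratDenReal s c x = ∑ l ∈ s.filter (fun l => 0 < l), c l * l / (l - x) := by
  unfold ratDenReal
  rw [← Finset.sum_filter_add_sum_filter_not s (fun l => 0 < l), add_eq_left]
  refine Finset.sum_eq_zero (fun l hl => ?_)
  rw [Finset.mem_filter] at hl
  have : l = 0 := le_antisymm (not_lt.1 hl.2) (hs l hl.1)
  simp [this]

/-- Each term `c λ · λ/(λ - x)` (`λ > 0`, `c > 0`) is strictly increasing in `x` on an interval
not containing `λ`. [folklore] -/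
lemma term_strictMono {l cl x x' : ℝ} (hl : 0 < l) (hcl : 0 < cl) (hxx' : x < x')
    (hnot : l < x ∨ x' < l) : cl * l / (l - x) < cl * l / (l - x') := by
  have hx : l - x ≠ 0 := by rcases hnot with h | h <;> [exact (by linarith : l - x ≠ 0);
    exact (by linarith : l - x ≠ 0)]
  have hx' : l - x' ≠ 0 := by rcases hnot with h | h <;> [exact (by linarith : l - x' ≠ 0);
    exact (by linarith : l - x' ≠ 0)]
  have hprod : 0 < (l - x) * (l - x') := by
    rcases hnot with h | h
    · exact mul_pos_of_neg_of_neg (by linarith) (by linarith)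
    · exact mul_pos (by linarith) (by linarith)
  rw [← sub_pos]
  have key : cl * l / (l - x') - cl * l / (l - x) = cl * l * (x' - x) / ((l - x) * (l - x')) := by
    field_simp
    ring
  rw [key]
  exact div_pos (mul_pos (mul_pos hcl hl) (by linarith)) hprod

/-- `D` is strictly increasing on an interval `[x, x']` containing no positive atom.
[cite: KacKrein1974, §2] -/
lemma ratDenReal_strictMono (hs : ∀ l ∈ s, 0 ≤ l) (hc : ∀ l ∈ s, 0 < c l)
    (hpos : ∃ l ∈ s, 0 < l) {x x' : ℝ} (hxx' : x < x')
    (hgap : ∀ l ∈ s, 0 < l → l < x ∨ x' < l) : ratDenReal s c x < ratDenReal s c x' := by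
  rw [ratDenReal_eq_pos hs, ratDenReal_eq_pos hs]
  obtain ⟨l₀, hl₀, hl₀pos⟩ := hpos
  refine Finset.sum_lt_sum (fun l hl => ?_) ⟨l₀, Finset.mem_filter.2 ⟨hl₀, hl₀pos⟩, ?_⟩
  · rw [Finset.mem_filter] at hl
    exact (term_strictMono hl.2 (hc l hl.1) hxx' (hgap l hl.1 hl.2)).le
  · exact term_strictMono hl₀pos (hc l₀ hl₀) hxx' (hgap l₀ hl₀ hl₀pos)

/-- `D > 0` to the left of all positive atoms. [folklore] -/
lemma ratDenReal_pos_of_lt (hs : ∀ l ∈ s, 0 ≤ l) (hc : ∀ l ∈ s, 0 < c l) (hpos : ∃ l ∈ s, 0 < l)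
    {x : ℝ} (hx : ∀ l ∈ s, 0 < l → x < l) : 0 < ratDenReal s c x := by
  rw [ratDenReal_eq_pos hs]
  obtain ⟨l₀, hl₀, hl₀pos⟩ := hpos
  refine Finset.sum_pos' (fun l hl => ?_) ⟨l₀, Finset.mem_filter.2 ⟨hl₀, hl₀pos⟩, ?_⟩
  · rw [Finset.mem_filter] at hl
    exact div_nonneg (mul_nonneg (hc l hl.1).le hl.2.le) (by linarith [hx l hl.1 hl.2])
  · exact div_pos (mul_pos (hc l₀ hl₀) hl₀pos) (by linarith [hx l₀ hl₀ hl₀pos])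

/-- `D < 0` to the right of all positive atoms. [folklore] -/
lemma ratDenReal_neg_of_gt (hs : ∀ l ∈ s, 0 ≤ l) (hc : ∀ l ∈ s, 0 < c l) (hpos : ∃ l ∈ s, 0 < l)
    {x : ℝ} (hx : ∀ l ∈ s, 0 < l → l < x) : ratDenReal s c x < 0 := by
  rw [ratDenReal_eq_pos hs]
  obtain ⟨l₀, hl₀, hl₀pos⟩ := hpos
  have h : 0 < ∑ l ∈ s.filter (fun l => 0 < l), -(c l * l / (l - x)) := by
    refine Finset.sum_pos' (fun l hl => ?_) ⟨l₀, Finset.mem_filter.2 ⟨hl₀, hl₀pos⟩, ?_⟩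
    · rw [Finset.mem_filter] at hl
      rw [neg_nonneg]
      exact div_nonpos_of_nonneg_of_nonpos (mul_nonneg (hc l hl.1).le hl.2.le)
        (by linarith [hx l hl.1 hl.2])
    · rw [neg_pos]
      exact div_neg_of_pos_of_neg (mul_pos (hc l₀ hl₀) hl₀pos) (by linarith [hx l₀ hl₀ hl₀pos])
  rw [Finset.sum_neg_distrib] at h
  linarith

/-- **Zero count**: a finite set of real zeros of `D` off the atoms has at most
`#{λ ∈ s : λ > 0} - 1` elements (one in each gap between consecutive positive atoms, none
outside). [cite: KacKrein1974, §2] -/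
theorem card_zeros_le (hs : ∀ l ∈ s, 0 ≤ l) (hc : ∀ l ∈ s, 0 < c l) (hpos : ∃ l ∈ s, 0 < l)
    (Z : Finset ℝ) (hZ : ∀ x ∈ Z, x ∉ s ∧ ratDenReal s c x = 0) :
    Z.card + 1 ≤ (s.filter (fun l => 0 < l)).card := by
  classical
  set P := s.filter (fun l => 0 < l) with hP
  obtain ⟨l₀, hl₀, hl₀pos⟩ := hpos
  have hPne : P.Nonempty := ⟨l₀, Finset.mem_filter.2 ⟨hl₀, hl₀pos⟩⟩
  have hmemP : ∀ {l}, l ∈ P ↔ l ∈ s ∧ 0 < l := fun {l} => Finset.mem_filter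
  -- every zero has a positive atom to its right and lies to the right of the smallest one
  have hright : ∀ x ∈ Z, (P.filter (fun l => x < l)).Nonempty := by
    intro x hx
    by_contra hne
    rw [Finset.not_nonempty_iff_eq_empty, Finset.filter_eq_empty_iff] at hne
    have hlt : ∀ l ∈ s, 0 < l → l < x := fun l hl hl0 => by
      have h1 : ¬ x < l := hne (hmemP.2 ⟨hl, hl0⟩)
      rcases lt_or_eq_of_le (not_lt.1 h1) with h | h
      · exact h
      · exact absurd (h ▸ hl) (hZ x hx).1
    have := ratDenReal_neg_of_gt (c := c) hs hc ⟨l₀, hl₀, hl₀pos⟩ hlt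
    linarith [(hZ x hx).2]
  have hleft : ∀ x ∈ Z, P.min' hPne < x := by
    intro x hx
    by_contra hle
    have hxm : x < P.min' hPne := by
      rcases lt_or_eq_of_le (not_lt.1 hle) with h | h
      · exact h
      · exact absurd (h ▸ (hmemP.1 (Finset.min'_mem P hPne)).1) (hZ x hx).1
    have hlt : ∀ l ∈ s, 0 < l → x < l := fun l hl hl0 =>
      hxm.trans_le (Finset.min'_le P l (hmemP.2 ⟨hl, hl0⟩))
    have := ratDenReal_pos_of_lt (c := c) hs hc ⟨l₀, hl₀, hl₀pos⟩ hlt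
    linarith [(hZ x hx).2]
  -- the next positive atom
  let next : ℝ → ℝ := fun x =>
    if h : (P.filter (fun l => x < l)).Nonempty then (P.filter (fun l => x < l)).min' h else 0
  have hnext : ∀ x ∈ Z, next x ∈ P ∧ x < next x ∧ ∀ l ∈ P, x < l → next x ≤ l := by
    intro x hx
    have h := hright x hx
    simp only [next, dif_pos h]
    have hm := Finset.min'_mem _ h
    rw [Finset.mem_filter] at hm
    exact ⟨hm.1, hm.2, fun l hl hxl => Finset.min'_le _ l (Finset.mem_filter.2 ⟨hl, hxl⟩)⟩
  have hmaps : Set.MapsTo next ↑Z ↑(P.erase (P.min' hPne)) := by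
    intro x hx
    rw [Finset.mem_coe] at hx
    rw [Finset.mem_coe, Finset.mem_erase]
    refine ⟨?_, (hnext x hx).1⟩
    have := (hleft x hx).trans (hnext x hx).2.1
    exact this.ne'
  have hkey : ∀ x ∈ Z, ∀ x' ∈ Z, next x = next x' → x < x' → False := by
    intro x hx x' hx' heq hxx'
    have hgap : ∀ l ∈ s, 0 < l → l < x ∨ x' < l := by
      intro l hl hl0
      rcases lt_or_ge l x with h | h
      · exact Or.inl h
      · right
        have hxl : x < l := by
          rcases lt_or_eq_of_le h with h' | h'
          · exact h'
          · exact absurd (h' ▸ hl) (hZ x hx).1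
        have h1 := (hnext x hx).2.2 l (hmemP.2 ⟨hl, hl0⟩) hxl
        rw [heq] at h1
        exact (hnext x' hx').2.1.trans_le h1
    have := ratDenReal_strictMono (c := c) hs hc ⟨l₀, hl₀, hl₀pos⟩ hxx' hgap
    linarith [(hZ x hx).2, (hZ x' hx').2]
  have hinj : Set.InjOn next ↑Z := by
    intro x hx x' hx' heq
    rw [Finset.mem_coe] at hx hx'
    by_contra hne
    rcases lt_or_gt_of_ne hne with h | h
    · exact hkey x hx x' hx' heq h
    · exact hkey x' hx' x hx heq.symm h
  have hcard := Finset.card_le_card_of_injOn next hmaps hinj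
  rw [Finset.card_erase_of_mem (Finset.min'_mem P hPne)] at hcard
  have hP1 : 1 ≤ P.card := Finset.card_pos.2 hPne
  omega

/-- **The real zeros of `D` off the atoms form a finite set.** [folklore] -/
theorem finite_zeros (hs : ∀ l ∈ s, 0 ≤ l) (hc : ∀ l ∈ s, 0 < c l) (hpos : ∃ l ∈ s, 0 < l) :
    {x : ℝ | x ∉ s ∧ ratDenReal s c x = 0}.Finite := by
  classical
  by_contra hinf
  rw [Set.not_finite] at hinf
  obtain ⟨Z, hZsub, hZcard⟩ := hinf.exists_subset_card_eq ((s.filter (fun l => 0 < l)).card)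
  have h := card_zeros_le hs hc hpos Z (fun x hx => hZsub hx)
  omega

/-! ### The Stieltjes measure of `r` lives on the zeros of `D` (and `0`) -/

section Support

variable {b' : ℝ} {σ' : Measure ℝ}

/-- `r` is real on the real axis. [folklore] -/
lemma im_ratNext_ofReal (x : ℝ) : (ratNext s c (x : ℂ)).im = 0 := by
  have h := ratNext_conj (s := s) (c := c) (x : ℂ)
  rw [Complex.conj_ofReal] at h
  exact Complex.conj_eq_iff_im.1 h.symm

/-- `N` and `D` are continuous at points where no denominator vanishes. [folklore] -/
lemma continuousAt_ratNum_ratDen {z : ℂ} (hz : ∀ l ∈ s, (l : ℂ) - z ≠ 0) :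
    ContinuousAt (ratNum s c) z ∧ ContinuousAt (ratDen s c) z := by
  constructor
  · unfold ratNum
    refine tendsto_finsetSum _ (fun l hl => ?_)
    exact (continuousAt_const.div (continuousAt_const.sub continuousAt_id) (hz l hl)).tendsto
  · unfold ratDen
    refine tendsto_finsetSum _ (fun l hl => ?_)
    exact (continuousAt_const.div (continuousAt_const.sub continuousAt_id) (hz l hl)).tendsto

/-- **`σ'` does not charge intervals of regularity of `r`**: if `[A, B]` contains no atom and no
zero of `D`, then `σ'((A, B)) = 0`. [cite: KacKrein1974, §2] -/
theorem measure_Ioo_eq_zero_of_regular (hs : ∀ l ∈ s, 0 ≤ l) (hc : ∀ l ∈ s, 0 < c l)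
    (hpos : ∃ l ∈ s, 0 < l) (h' : HasStieltjesRepresentation (ratNext s c) b' σ') {A B : ℝ}
    (hreg : ∀ x ∈ Set.Icc A B, x ∉ s ∧ ratDenReal s c x ≠ 0) : σ' (Set.Ioo A B) = 0 := by
  refine measure_Ioo_eq_zero_of_im_tendsto_zero h' (fun ε hε => ?_)
  -- the compact rectangle over `[A, B]`
  set K : Set ℂ :=
    (fun p : ℝ × ℝ => (p.1 : ℂ) + (p.2 : ℂ) * Complex.I) '' (Set.Icc A B ×ˢ Set.Icc 0 1) with hK
  have hKc : IsCompact K := (isCompact_Icc.prod isCompact_Icc).image (by fun_prop)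
  -- no denominator vanishes on `K`, and `D ≠ 0` there
  have hden : ∀ z ∈ K, (∀ l ∈ s, (l : ℂ) - z ≠ 0) ∧ ratDen s c z ≠ 0 := by
    rintro z ⟨⟨x, y⟩, ⟨hx, hy⟩, rfl⟩
    simp only at hx hy ⊢
    rcases eq_or_lt_of_le hy.1 with hy0 | hy0
    · subst hy0
      simp only [Complex.ofReal_zero, zero_mul, add_zero]
      refine ⟨fun l hl h0 => ?_, ?_⟩
      · have : l = x := by exact_mod_cast sub_eq_zero.1 h0
        exact (hreg x hx).1 (this ▸ hl)
      · rw [ratDen_ofReal]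
        exact_mod_cast (hreg x hx).2
    · have hz : ((x : ℂ) + (y : ℂ) * Complex.I) ∈ offNonnegAxis := Or.inl (by simpa using hy0.ne')
      exact ⟨sub_ne_zero_of_mem hs hz, ratDen_ne_zero hs hc hpos hz⟩
  have hcont : ContinuousOn (ratNext s c) K := by
    intro z hz
    obtain ⟨h1, h2⟩ := continuousAt_ratNum_ratDen (c := c) (hden z hz).1
    exact ((h1.div h2 (hden z hz).2).const_mul _).continuousWithinAt
  obtain ⟨δ, hδ, hδK⟩ :=
    Metric.uniformContinuousOn_iff.1 (hKc.uniformContinuousOn_of_continuous hcont) ε hε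
  have hmemK : ∀ x ∈ Set.Icc A B, ∀ y ∈ Set.Icc (0 : ℝ) 1, ((x : ℂ) + (y : ℂ) * Complex.I) ∈ K :=
    fun x hx y hy => ⟨(x, y), ⟨hx, hy⟩, rfl⟩
  filter_upwards [Ioo_mem_nhdsGT (lt_min hδ one_pos)] with y hy x hx
  have hy1 : y ∈ Set.Icc (0 : ℝ) 1 := ⟨hy.1.le, (hy.2.trans_le (min_le_right _ _)).le⟩
  have hdist : dist ((x : ℂ) + (y : ℂ) * Complex.I) ((x : ℂ) + ((0 : ℝ) : ℂ) * Complex.I) < δ := by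
    rw [dist_eq_norm]
    simp only [Complex.ofReal_zero, zero_mul, add_zero, add_sub_cancel_left, Complex.norm_mul,
      Complex.norm_real, Complex.norm_I, mul_one, Real.norm_eq_abs, abs_of_pos hy.1]
    exact hy.2.trans_le (min_le_left _ _)
  have h := hδK _ (hmemK x hx y hy1) _ (hmemK x hx 0 ⟨le_rfl, zero_le_one⟩) hdist
  rw [dist_eq_norm] at h
  have him : (ratNext s c ((x : ℂ) + (y : ℂ) * Complex.I)).im =
      (ratNext s c ((x : ℂ) + (y : ℂ) * Complex.I) -
        ratNext s c ((x : ℂ) + ((0 : ℝ) : ℂ) * Complex.I)).im := by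
    rw [Complex.sub_im]
    simp only [Complex.ofReal_zero, zero_mul, add_zero, im_ratNext_ofReal, sub_zero]
  rw [him]
  exact (Complex.abs_im_le_norm _).trans h.le

/-- **No atom of `σ'` at a positive atom of `σ`**: there `r` has a removable singularity
(`r → (Σ c)/λ`). [cite: KacKrein1974, §2] -/
theorem measure_singleton_eq_zero_of_mem (hs : ∀ l ∈ s, 0 ≤ l) (hc : ∀ l ∈ s, 0 < c l)
    (h' : HasStieltjesRepresentation (ratNext s c) b' σ') {lam : ℝ} (hlam : lam ∈ s)
    (hlam0 : 0 < lam) : σ' {lam} = 0 := by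
  classical
  haveI := isLocallyFiniteMeasure_of_hasStieltjesRepresentation h'
  have hpos : ∃ l ∈ s, 0 < l := ⟨lam, hlam, hlam0⟩
  have hclam : 0 < c lam := hc lam hlam
  set s' := s.erase lam with hs'
  -- the regularised numerator and denominator
  set Nt : ℂ → ℂ := fun z => (c lam : ℂ) + ((lam : ℂ) - z) * ∑ l ∈ s', (c l : ℂ) / ((l : ℂ) - z)
    with hNt
  set Dt : ℂ → ℂ := fun z =>
    (c lam : ℂ) * lam + ((lam : ℂ) - z) * ∑ l ∈ s', (c l : ℂ) * l / ((l : ℂ) - z) with hDt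
  have hNeq : ∀ z : ℂ, (∀ l ∈ s, (l : ℂ) - z ≠ 0) → ratNum s c z * ((lam : ℂ) - z) = Nt z := by
    intro z hz
    simp only [hNt, ratNum]
    rw [← Finset.add_sum_erase s _ hlam]
    field_simp [hz lam hlam]
    rfl
  have hDeq : ∀ z : ℂ, (∀ l ∈ s, (l : ℂ) - z ≠ 0) → ratDen s c z * ((lam : ℂ) - z) = Dt z := by
    intro z hz
    simp only [hDt, ratDen]
    rw [← Finset.add_sum_erase s _ hlam]
    field_simp [hz lam hlam]
    rfl
  have hne' : ∀ l ∈ s', (l : ℂ) - lam ≠ 0 := fun l hl => by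
    rw [Finset.mem_erase] at hl
    exact_mod_cast sub_ne_zero.2 hl.1
  have hNc : ContinuousAt Nt lam := by
    simp only [hNt]
    refine continuousAt_const.add ((continuousAt_const.sub continuousAt_id).mul ?_)
    refine tendsto_finsetSum _ (fun l hl => ?_)
    exact (continuousAt_const.div (continuousAt_const.sub continuousAt_id) (hne' l hl)).tendsto
  have hDc : ContinuousAt Dt lam := by
    simp only [hDt]
    refine continuousAt_const.add ((continuousAt_const.sub continuousAt_id).mul ?_)
    refine tendsto_finsetSum _ (fun l hl => ?_)
    exact (continuousAt_const.div (continuousAt_const.sub continuousAt_id) (hne' l hl)).tendsto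
  have hNl : Nt lam = c lam := by simp [hNt]
  have hDl : Dt lam = (c lam : ℂ) * lam := by simp [hDt]
  have hcl : 0 < c lam * lam := mul_pos (hc lam hlam) hlam0
  obtain ⟨δ₁, hδ₁, hD1⟩ := Metric.continuousAt_iff.1 hDc (c lam * lam / 2) (by positivity)
  obtain ⟨δ₂, hδ₂, hN1⟩ := Metric.continuousAt_iff.1 hNc 1 one_pos
  -- the bound on `r` near `λ`
  set C := ∑ l ∈ s, c l with hC
  have hC0 : 0 ≤ C := Finset.sum_nonneg fun l hl => (hc l hl).le
  set M := C * (c lam + 1) / (c lam * lam / 2) with hM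
  have hbound : ∀ y : ℝ, 0 < y → y < min δ₁ δ₂ →
      ‖ratNext s c ((lam : ℂ) + (y : ℂ) * Complex.I)‖ ≤ M := by
    intro y hy hyd
    set z : ℂ := (lam : ℂ) + (y : ℂ) * Complex.I with hzdef
    have hz : z ∈ offNonnegAxis := Or.inl (by simp [hzdef, hy.ne'])
    have hden := sub_ne_zero_of_mem hs hz
    have hdist : dist z lam < min δ₁ δ₂ := by
      rw [dist_eq_norm]
      simp [hzdef, abs_of_pos hy, hyd]
    have hDz : c lam * lam / 2 ≤ ‖Dt z‖ := by
      have h1 := hD1 (hdist.trans_le (min_le_left _ _))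
      rw [dist_eq_norm, hDl] at h1
      have h2 : ‖(c lam : ℂ) * lam‖ = c lam * lam := by
        rw [← Complex.ofReal_mul, Complex.norm_real, Real.norm_eq_abs, abs_of_pos hcl]
      have := norm_sub_norm_le ((c lam : ℂ) * lam) (Dt z)
      rw [norm_sub_rev] at h1
      linarith
    have hNz : ‖Nt z‖ ≤ c lam + 1 := by
      have h1 := hN1 (hdist.trans_le (min_le_right _ _))
      rw [dist_eq_norm, hNl] at h1
      have h2 : ‖(c lam : ℂ)‖ = c lam := by
        rw [Complex.norm_real, Real.norm_eq_abs, abs_of_pos (hc lam hlam)]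
      have := norm_le_norm_add_norm_sub' (Nt z) (c lam : ℂ)
      rw [norm_sub_rev] at this
      linarith [norm_sub_rev (Nt z) (c lam : ℂ)]
    have hDz0 : Dt z ≠ 0 := fun h0 => by
      rw [h0, norm_zero] at hDz
      linarith
    have hr : ratNext s c z = (C : ℂ) * (Nt z / Dt z) := by
      rw [ratNext_def, ← hNeq z hden, ← hDeq z hden, mul_div_mul_right _ _ (hden lam hlam)]
    rw [hr, norm_mul, Complex.norm_real, Real.norm_eq_abs, abs_of_nonneg hC0, norm_div, hM]
    rw [le_div_iff₀ (by positivity)]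
    calc C * (‖Nt z‖ / ‖Dt z‖) * (c lam * lam / 2) = C * ‖Nt z‖ * ((c lam * lam / 2) / ‖Dt z‖) := by
          ring
      _ ≤ C * (c lam + 1) * 1 := by
          refine mul_le_mul (mul_le_mul_of_nonneg_left hNz hC0) ?_ (by positivity) (by positivity)
          exact (div_le_one (by linarith)).2 hDz
      _ = C * (c lam + 1) := mul_one _
  -- conclusion from the atom bound
  have hM0 : 0 ≤ M := by positivity
  have hfin : σ' {lam} < ⊤ := measure_singleton_lt_top
  have hle : ∀ y : ℝ, 0 < y → y < min δ₁ δ₂ → (σ' {lam}).toReal ≤ y * M := by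
    intro y hy hyd
    refine (measureReal_singleton_le h' lam hy).trans (mul_le_mul_of_nonneg_left ?_ hy.le)
    exact (Complex.abs_im_le_norm _).trans' (le_abs_self _) |>.trans (hbound y hy hyd)
  have h0 : (σ' {lam}).toReal ≤ 0 := by
    refine le_of_forall_pos_le_add (fun ε hε => ?_)
    have hy : 0 < min (min δ₁ δ₂ / 2) (ε / (M + 1)) := by positivity
    have h1 := hle _ hy ((min_le_left _ _).trans_lt (by linarith [lt_min hδ₁ hδ₂]))
    calc (σ' {lam}).toReal ≤ min (min δ₁ δ₂ / 2) (ε / (M + 1)) * M := h1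
      _ ≤ ε / (M + 1) * M := mul_le_mul_of_nonneg_right (min_le_right _ _) hM0
      _ ≤ 0 + ε := by
          rw [zero_add, div_mul_eq_mul_div, div_le_iff₀ (by positivity)]
          nlinarith
  have : (σ' {lam}).toReal = 0 := le_antisymm h0 ENNReal.toReal_nonneg
  exact ((ENNReal.toReal_eq_zero_iff _).1 this).resolve_right hfin.ne

/-- `D` (real form) is continuous off the atoms. [folklore] -/
lemma continuousAt_ratDenReal {x : ℝ} (hx : x ∉ s) : ContinuousAt (ratDenReal s c) x := by
  unfold ratDenReal
  refine tendsto_finsetSum _ (fun l hl => ?_)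
  have : l - x ≠ 0 := sub_ne_zero.2 (fun h => hx (h ▸ hl))
  exact (continuousAt_const.div (continuousAt_const.sub continuousAt_id) this).tendsto

/-- The regular set `{x ∉ s, D(x) ≠ 0}` is open. [folklore] -/
lemma isOpen_regular : IsOpen {x : ℝ | x ∉ s ∧ ratDenReal s c x ≠ 0} := by
  rw [isOpen_iff_mem_nhds]
  rintro x ⟨hxs, hxD⟩
  have h1 : ∀ᶠ y in 𝓝 x, y ∉ s := by
    have : IsOpen ((↑s : Set ℝ)ᶜ) := s.finite_toSet.isClosed.isOpen_compl
    exact this.mem_nhds hxs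
  have h2 : ∀ᶠ y in 𝓝 x, ratDenReal s c y ≠ 0 :=
    (continuousAt_ratDenReal (c := c) hxs).eventually_ne hxD
  exact h1.and h2

/-- **`σ'` does not charge the regular set.** [cite: KacKrein1974, §2] -/
theorem measure_regular_eq_zero (hs : ∀ l ∈ s, 0 ≤ l) (hc : ∀ l ∈ s, 0 < c l)
    (hpos : ∃ l ∈ s, 0 < l) (h' : HasStieltjesRepresentation (ratNext s c) b' σ') :
    σ' {x : ℝ | x ∉ s ∧ ratDenReal s c x ≠ 0} = 0 := by
  set G := {x : ℝ | x ∉ s ∧ ratDenReal s c x ≠ 0} with hG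
  -- cover `G` by rational intervals whose closures lie in `G`
  have hcover : G ⊆ ⋃ (pq : ℚ × ℚ) (_ : Set.Icc (pq.1 : ℝ) pq.2 ⊆ G), Set.Ioo (pq.1 : ℝ) pq.2 := by
    intro x hx
    obtain ⟨η, hη, hball⟩ := Metric.isOpen_iff.1 isOpen_regular x hx
    obtain ⟨p, hp1, hp2⟩ := exists_rat_btwn (by linarith : x - η / 2 < x)
    obtain ⟨q, hq1, hq2⟩ := exists_rat_btwn (by linarith : x < x + η / 2)
    refine Set.mem_iUnion₂.2 ⟨(p, q), fun y hy => hball ?_, ⟨hp2, hq1⟩⟩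
    rw [Metric.mem_ball, Real.dist_eq, abs_lt]
    constructor <;> linarith [hy.1, hy.2]
  refine measure_mono_null hcover ?_
  refine measure_iUnion_null (fun pq => measure_iUnion_null (fun hpq => ?_))
  exact measure_Ioo_eq_zero_of_regular hs hc hpos h' (fun x hx => hpq hx)

/-- **The Stieltjes measure of `r` is finitely atomic**, carried by the zeros of `D` off the
atoms together with `0` (if `0` is an atom): at most `#s - 1` points, all in `[0, ∞)`.
[cite: KacKrein1974, §2] -/
theorem exists_finset_carrier (hs : ∀ l ∈ s, 0 ≤ l) (hc : ∀ l ∈ s, 0 < c l)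
    (hpos : ∃ l ∈ s, 0 < l) (h' : HasStieltjesRepresentation (ratNext s c) b' σ') :
    ∃ F : Finset ℝ, F.card + 1 ≤ s.card ∧ (∀ p ∈ F, 0 ≤ p) ∧
      σ' = ∑ p ∈ F, σ' {p} • Measure.dirac p := by
  classical
  set Z := (finite_zeros (c := c) hs hc hpos).toFinset with hZ
  have hZmem : ∀ x, x ∈ Z ↔ x ∉ s ∧ ratDenReal s c x = 0 := fun x => by
    rw [hZ, Set.Finite.mem_toFinset]; rfl
  set F := Z ∪ s.filter (fun l => l = 0) with hF
  have hPcard : (s.filter (fun l => 0 < l)).card + (s.filter (fun l => l = 0)).card = s.card := by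
    rw [← Finset.card_union_of_disjoint]
    · congr 1
      ext l
      simp only [Finset.mem_union, Finset.mem_filter]
      constructor
      · rintro (⟨h, -⟩ | ⟨h, -⟩) <;> exact h
      · intro h
        rcases eq_or_lt_of_le (hs l h) with h0 | h0
        · exact Or.inr ⟨h, h0.symm⟩
        · exact Or.inl ⟨h, h0⟩
    · rw [Finset.disjoint_left]
      intro l h1 h2
      rw [Finset.mem_filter] at h1 h2
      linarith [h1.2, h2.2.le]
  have hZcard := card_zeros_le hs hc hpos Z (fun x hx => (hZmem x).1 hx)
  refine ⟨F, ?_, ?_, ?_⟩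
  · have hU : F.card ≤ Z.card + (s.filter (fun l => l = 0)).card :=
      Finset.card_union_le Z (s.filter (fun l => l = 0))
    omega
  · intro p hp
    rw [hF, Finset.mem_union] at hp
    rcases hp with hp | hp
    · -- zeros lie to the right of the smallest positive atom
      obtain ⟨hps, hpD⟩ := (hZmem p).1 hp
      by_contra hneg
      have hlt : ∀ l ∈ s, 0 < l → p < l := fun l _ hl => (not_le.1 hneg).trans hl
      have := ratDenReal_pos_of_lt (c := c) hs hc hpos hlt
      linarith
    · rw [Finset.mem_filter] at hp
      exact hp.2.ge
  · rw [← Measure.ae_mem_finset_iff, ae_iff]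
    have hsub : {a : ℝ | ¬a ∈ F} ⊆ {x : ℝ | x ∉ s ∧ ratDenReal s c x ≠ 0} ∪
        ↑(s.filter (fun l => 0 < l)) := by
      intro x hx
      simp only [Set.mem_setOf_eq, hF, Finset.mem_union, not_or, Finset.mem_filter] at hx
      by_cases hxs : x ∈ s
      · right
        rw [Finset.mem_coe, Finset.mem_filter]
        refine ⟨hxs, ?_⟩
        rcases eq_or_lt_of_le (hs x hxs) with h0 | h0
        · exact absurd ⟨hxs, h0.symm⟩ hx.2
        · exact h0
      · left
        exact ⟨hxs, fun hD => hx.1 ((hZmem x).2 ⟨hxs, hD⟩)⟩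
    refine measure_mono_null hsub ?_
    rw [measure_union_null_iff]
    refine ⟨measure_regular_eq_zero hs hc hpos h', ?_⟩
    rw [measure_null_iff_singleton (Finset.countable_toSet _)]
    intro x hx
    rw [Finset.mem_coe, Finset.mem_filter] at hx
    exact measure_singleton_eq_zero_of_mem hs hc h' hx.1 hx.2

/-- Integral of the Cauchy kernel against a finite combination of Dirac masses. [folklore] -/
lemma integral_inv_sub_sum_dirac (F : Finset ℝ) (w : ℝ → ℝ≥0∞) (hw : ∀ p ∈ F, w p ≠ ⊤) (z : ℂ) :
    ∫ t : ℝ, ((t : ℂ) - z)⁻¹ ∂(∑ p ∈ F, w p • Measure.dirac p) =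
      ∑ p ∈ F, ((w p).toReal : ℂ) / ((p : ℂ) - z) := by
  rw [integral_finsetSum_measure (fun p hp => ?_)]
  · refine Finset.sum_congr rfl (fun p hp => ?_)
    rw [integral_smul_measure, integral_dirac, div_eq_mul_inv, Complex.real_smul]
  · exact ((integrable_dirac (by simp)).smul_measure (hw p hp))

/-- **The inverse Stieltjes step, finitely atomic form**: `r = b' + Σ_{p ∈ F} c'_p/(p - z)` off
`[0, ∞)` with `#F ≤ #s - 1` atoms `p ≥ 0`, weights `c'_p > 0` and `b' ≥ 0`.
[cite: KacKrein1974, §2] -/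
theorem ratNext_eq_finite (hs : ∀ l ∈ s, 0 ≤ l) (hc : ∀ l ∈ s, 0 < c l) (hpos : ∃ l ∈ s, 0 < l) :
    ∃ (F : Finset ℝ) (c' : ℝ → ℝ) (b' : ℝ), F.card + 1 ≤ s.card ∧ (∀ p ∈ F, 0 ≤ p) ∧
      (∀ p ∈ F, 0 < c' p) ∧ 0 ≤ b' ∧
      ∀ z ∈ offNonnegAxis, ratNext s c z = b' + ratNum F c' z := by
  classical
  obtain ⟨b', σ', h'⟩ := isNevanlinnaStieltjes_ratNext hs hc hpos
  haveI := isLocallyFiniteMeasure_of_hasStieltjesRepresentation h'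
  obtain ⟨F₀, hcard, hF0, hσ'⟩ := exists_finset_carrier hs hc hpos h'
  set c' : ℝ → ℝ := fun p => (σ' {p}).toReal with hc'
  refine ⟨F₀.filter (fun p => 0 < c' p), c', b', ?_, fun p hp => hF0 p (Finset.mem_filter.1 hp).1,
    fun p hp => (Finset.mem_filter.1 hp).2, h'.1, fun z hz => ?_⟩
  · have := Finset.card_filter_le F₀ (fun p => 0 < c' p)
    omega
  rw [h'.2.2.2 z hz]
  congr 1
  rw [hσ', integral_inv_sub_sum_dirac F₀ _ (fun p _ => measure_singleton_lt_top.ne) z]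
  unfold ratNum
  rw [Finset.sum_filter]
  refine Finset.sum_congr rfl (fun p hp => ?_)
  by_cases h0 : 0 < c' p
  · rw [if_pos h0]
  · rw [if_neg h0]
    have : c' p = 0 := le_antisymm (not_lt.1 h0) ENNReal.toReal_nonneg
    simp only [hc'] at this
    rw [this, Complex.ofReal_zero, zero_div]

end Support

end StieltjesRational

end Literature.Analysis.InverseSpectral

end
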